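import Mathlib.GroupTheory.QuotientGroup.Defs
import Mathlib.LinearAlgebra.Matrix.ToLin
import Mathlib.LinearAlgebra.Determinant
import Mathlib.Topology.Algebra.Module.FiniteDimension
import Literature.NumberTheory.Transcendental.KZProduct
import Literature.NumberTheory.Transcendental.SemialgebraicMapsProofs
import Literature.ModelTheory.ExponentialFields.TarskiSeidenbergProofs
import HarnessLib

/-!
# The KZ calculus: `relations` is a two-sided ideal and `*` is commutative modulo it (proof file)

Sibling proof file of `Literature/NumberTheory/Transcendental/KZProduct.lean`. That file equips
the formal group `Literature.NumberTheory.Transcendental.KZ.FormalRep` of the Kontsevich–Zagier calculus with the product `*`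
(Fubini: `[σ, f] * [τ, g] = [σ × τ, f ⊗ g]`), names the *ideal properties*
`Literature.KZ.mul_mem_relations_left/right` (`c ∈ relations → c' * c ∈ relations`, resp. `c * c'`) as
folklore facts (not proved there), and states the two theses `Literature.NumberTheory.Transcendental.KZ.PiCancellation`,
`Literature.NumberTheory.Transcendental.KZ.PiLocalKernel` of route KontsevichZagierPeriods/AyoubSpecialisation along the element
`[π] = [{x² + y² ≤ 1}, 1]`. This file discharges the two ideal facts, proves that `*` is
commutative modulo `relations`, and records what this says about `PiCancellation`.

Sources. Kontsevich [Kontsevich 1999, §4.3, p. 16 (after Definition 20)]: "The effective periods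
form an algebra because the product of integrals is again an integral (Fubini formula). … It is
convenient to extend the algebra of effective periods to a larger algebra `P` by inverting formally
the element whose evaluation in `ℂ` is `2πi`. Informally, … `P` is `P₊[(2πi)⁻¹]`"; the same two
sentences are [Kontsevich–Zagier 2001, §4.1, p. 31]. That the *moves* (KZ's rules (1)–(3),
[Kontsevich–Zagier 2001, §1.2]) are compatible with products — so that the product descends to
formal periods modulo the rules — is used implicitly there and is not spelled out in print for
this calculus; this file supplies the proof. The Tarski–Seidenberg input (products of real
semialgebraic functions are semialgebraic, BCR Prop. 2.2.6) is the theorem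
`Literature.ModelTheory.ExponentialFields.tarski_seidenberg_real_holds` of `Literature/ModelTheory/ExponentialFields/
TarskiSeidenbergProofs.lean` through `IsSemialgebraicFunOn.mul_of_tarskiSeidenberg`.

## Main statements (all proved; no `sorry`)

* `Literature.NumberTheory.Transcendental.KZ.of_mul_mem_relations` — `c ∈ relations → [t] * c ∈ relations` for every representation
  `t`: each of the four moves is sent to a move of the same kind
  (`of_mul_mem_relations_of_mem_domainAddRel/…integrandAddRel/…changeOfVariablesRel/
  …newtonLeibnizRel`): `τ × (σ₁ ∪ σ₂)` with `vol (τ × N) = vol τ · 0 = 0`; `g ⊗ (f₁ + f₂)`;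
  the block change of variables `(y, x) ↦ (y, Φ x)` with `|det| = |det Φ'|`; and a band in the
  last coordinate over `τ'` becomes a band over `τ × τ'` with primitive `g ⊗ F`. The lemmas are
  proved relative to the predicate `IntegralRep.LeftResolves t` ("`g ⊗ F` is semialgebraic for
  every semialgebraic `F`"), which holds for every `t` (`IntegralRep.leftResolves`,
  Tarski–Seidenberg) and for `[π]` even without Tarski–Seidenberg (`piRep_leftResolves`).
* **`Literature.KZ.mul_mem_relations_left_holds : mul_mem_relations_left`** — discharge of the named
  left-ideal fact (additivity in the left factor).
* `Literature.NumberTheory.Transcendental.KZ.IntegralRep.reindex`, **`Literature.NumberTheory.Transcendental.KZ.of_sub_of_reindex_mem_relations`** — relabelling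
  coordinates along `e : Fin n ≃ Fin k` is a change-of-variables move (`|det| = 1`);
  `IntegralRep.prod_eq_reindex_prod : r.prod s = (s.prod r).reindex finAddFlip` (an equality of
  representations), hence **`Literature.NumberTheory.Transcendental.KZ.mul_sub_mul_comm_mem_relations`**:
  `c * d − d * c ∈ relations` for all `c d` — the product is commutative on formal periods.
* **`Literature.KZ.mul_mem_relations_right_holds : mul_mem_relations_right`** — discharge of the named
  right-ideal fact (left ideal + commutativity); `mul_sub_mul_mem_relations` (two-sided ideal:
  `*` descends to `FormalRep ⧸ relations`), `Equivalent.prod`.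
* `Literature.KZ.prodFunSemialgebraic_holds : ProdFunSemialgebraic`, `IntegralRep.value_prod`,
  `eval_mul'` — the classical `if` in `IntegralRep.prod` always takes its intended branch, so
  `value [σ × τ, f ⊗ g] = value [σ, f] · value [τ, g]` and `eval (c * c') = eval c · eval c'`
  hold outright.
* `Literature.NumberTheory.Transcendental.KZ.piRep_mul_mem_relations`, `mul_piRep_mem_relations`, `piRep_mul_iterate_mem_relations`,
  `Equivalent.piRep_prod` — the case `t = [π]`; **`Literature.NumberTheory.Transcendental.KZ.piCancellation_iff_injective`** —
  `[π] * ·` descends to an endomorphism `piMulQuot` of `FormalRep ⧸ relations`, and the thesis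
  `PiCancellation` is *literally* the statement that this endomorphism is injective (`[π]` is a
  regular element of the formal period ring), as presupposed by route AyoubSpecialisation
  (stmt-KontsevichZagierPeriods-0540). Nothing is claimed about `PiCancellation` itself: its
  motivic form — injectivity of `P̃(MM^eff_Nori) → P̃(MM_Nori) = P̃^eff[1/2πi]` — is recorded as
  an open question in [Huber–Wüstholz 2022, App. A, p. 200] (a consequence of the period
  conjecture, ibid. Prop. 7.17; known for 1-motives, ibid. Thm. 13.5).

## References

* M. Kontsevich, *Operads and Motives in Deformation Quantization*, Lett. Math. Phys. 48 (1999),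
  arXiv:math/9904055, §4.3 (p. 16).
* M. Kontsevich, D. Zagier, *Periods*, in: Mathematics Unlimited — 2001 and Beyond, Springer
  (2001), §1.2 (rules (1)–(3)), §4.1 (p. 31).
* J. Bochnak, M. Coste, M.-F. Roy, *Real Algebraic Geometry*, Springer (1998), §2.1, Thm. 2.2.1,
  Prop. 2.2.6.
* A. Huber, S. Müller-Stach, *Periods and Nori Motives*, Springer (2017), §13.1.
* A. Huber, G. Wüstholz, *Transcendence and Linear Relations of 1-Periods*, Cambridge Tracts 227
  (2022), App. A (p. 198, p. 200).

## Design notes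

* Only Mathlib and Literature imports; nothing under `Problems/` is touched. Right products are
  not treated move by move (for `(Newton–Leibniz) * [t]` the fibre coordinate is no longer last);
  instead the block flip `σ × τ ↔ τ × σ` is shown to be a move, which gives commutativity modulo
  relations and reduces the right-ideal property to the left one.
* Associativity modulo relations (`(r.prod s).prod u` versus `r.prod (s.prod u)`, related by the
  reindexing `finCongr (Nat.add_assoc _ _ _)`) is not needed downstream (powers of `[π]` are
  left-nested in `PiLocalKernel`) and is left out; `of_sub_of_reindex_mem_relations` is the tool.
* Index conventions follow `KZProduct.lean`: first `l` coordinates via `Fin.castAdd`, last `d` via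
  `Fin.natAdd`; the identification `Fin (l + (n + 1)) = Fin ((l + n) + 1)` is definitional, which
  is what makes `[t] * (band over τ')` literally a band in the last coordinate. The cylinder
  lemmas `isSemialgebraic_cylinder`, `isSemialgebraicFunOn_cylinder_left/right` generalise
  `IntegralRep.isSemialgebraic_prodDomain`, `isSemialgebraicFunOn_fst/snd` of `KZProduct.lean` to
  an arbitrary semialgebraic factor `B` and function `F` (needed for the Newton–Leibniz primitive
  and bounds); a later clean-up may derive the special cases from them.
-/

noncomputable section

open MeasureTheory MvPolynomial Set

namespace Literature.NumberTheory.Transcendental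

namespace KZ

variable {l n m d : ℕ}

/-! ### Index bookkeeping -/

/-- `Fin.snoc z s` restricted to the last `n + 1` coordinates is `Fin.snoc (z|ⁿ) s`: the pointwise
form of Mathlib's `Fin.snoc_comp_natAdd`, stated for use under binders by `simp` (the leading
block is Mathlib's `Fin.snoc_castAdd`). [folklore] -/
theorem snoc_natAdd (z : Fin (l + n) → ℝ) (s : ℝ) (j : Fin (n + 1)) :
    (Fin.snoc z s : Fin (l + n + 1) → ℝ) (Fin.natAdd l j) =
      (Fin.snoc (fun j => z (Fin.natAdd l j)) s : Fin (n + 1) → ℝ) j :=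
  congrFun (Fin.snoc_comp_natAdd z s) j

/-- `Fin.init w` on the first `l` coordinates. [folklore] -/
theorem init_castAdd (w : Fin (l + n + 1) → ℝ) (i : Fin l) :
    Fin.init w (Fin.castAdd n i) = w (Fin.castAdd (n + 1) i) := by
  rw [Fin.init, Fin.castSucc_castAdd]

/-- `Fin.init w` on the trailing block is `Fin.init` of the trailing block. [folklore] -/
theorem init_natAdd (w : Fin (l + n + 1) → ℝ) (j : Fin n) :
    Fin.init w (Fin.natAdd l j) = Fin.init (fun j => w (Fin.natAdd l j)) j := by
  simp only [Fin.init]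
  rw [Fin.castSucc_natAdd]

/-- The last coordinate of the trailing block is the last coordinate. [folklore] -/
theorem apply_natAdd_last (w : Fin (l + n + 1) → ℝ) :
    w (Fin.natAdd l (Fin.last n)) = w (Fin.last (l + n)) := by
  rw [Fin.natAdd_last]

/-! ### Cylinders -/

/-- Under `Fin.append`, the cylinder `{z | z|ₗ ∈ A ∧ z|ᵈ ∈ B}` is the product set `A ×ˢ B`.
[folklore] -/
theorem preimage_appendMeasurableEquiv_cylinder (A : Set (Fin l → ℝ)) (B : Set (Fin d → ℝ)) :
    appendMeasurableEquiv l d ⁻¹'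
      {z | (fun i => z (Fin.castAdd d i)) ∈ A ∧ (fun j => z (Fin.natAdd l j)) ∈ B} = A ×ˢ B := by
  ext p
  simp

/-- **`vol (A × B) = vol A · vol B`** for the cylinder in `ℝˡ⁺ᵈ` (Lebesgue measure is the product
measure along `Fin.append`, `volume_preserving_appendMeasurableEquiv`). [folklore] -/
theorem volume_cylinder (A : Set (Fin l → ℝ)) (B : Set (Fin d → ℝ)) :
    volume {z : Fin (l + d) → ℝ | (fun i => z (Fin.castAdd d i)) ∈ A ∧
      (fun j => z (Fin.natAdd l j)) ∈ B} = volume A * volume B := by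
  rw [← volume_preserving_appendMeasurableEquiv.measure_preimage_equiv,
    preimage_appendMeasurableEquiv_cylinder, Measure.volume_eq_prod, Measure.prod_prod]

/-- The cylinder over two `ℚ`-semialgebraic sets is `ℚ`-semialgebraic (two coordinate preimages;
no Tarski–Seidenberg). [BCR 1998, §2.1] [cite: BochnakCosteRoy1998, §2.1] -/
theorem isSemialgebraic_cylinder {A : Set (Fin l → ℝ)} {B : Set (Fin d → ℝ)}
    (hA : Literature.ModelTheory.ExponentialFields.IsSemialgebraic ℚ A) (hB : Literature.ModelTheory.ExponentialFields.IsSemialgebraic ℚ B) :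
    Literature.ModelTheory.ExponentialFields.IsSemialgebraic ℚ {z : Fin (l + d) → ℝ | (fun i => z (Fin.castAdd d i)) ∈ A ∧
      (fun j => z (Fin.natAdd l j)) ∈ B} :=
  (hA.preimage_comp (Fin.castAdd d)).inter (hB.preimage_comp (Fin.natAdd l))

/-- A `ℚ`-semialgebraic function of the trailing block, `z ↦ F (z|ᵈ)`, is `ℚ`-semialgebraic on the
cylinder `A × B` (its graph is a coordinate preimage of the graph of `F` cut down to the cylinder;
no Tarski–Seidenberg). [BCR 1998, §2.2] [cite: BochnakCosteRoy1998, §2.2] -/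
theorem isSemialgebraicFunOn_cylinder_right {A : Set (Fin l → ℝ)} {B : Set (Fin d → ℝ)}
    {F : (Fin d → ℝ) → ℝ} (hA : Literature.ModelTheory.ExponentialFields.IsSemialgebraic ℚ A) (hB : Literature.ModelTheory.ExponentialFields.IsSemialgebraic ℚ B)
    (hF : IsSemialgebraicFunOn ℚ B F) :
    IsSemialgebraicFunOn ℚ {z : Fin (l + d) → ℝ | (fun i => z (Fin.castAdd d i)) ∈ A ∧
      (fun j => z (Fin.natAdd l j)) ∈ B} (fun z => F fun j => z (Fin.natAdd l j)) := by
  rw [isSemialgebraicFunOn_iff]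
  let ρ : Fin (d + 1) → Fin (l + d + 1) :=
    Fin.lastCases (Fin.last (l + d)) fun j => Fin.castSucc (Fin.natAdd l j)
  have hΓ := (isSemialgebraicFunOn_iff.mp hF).preimage_comp ρ
  convert (isSemialgebraic_cylinder hA hB).setOf_init_mem.inter hΓ using 1
  have hinit : ∀ w : Fin (l + d + 1) → ℝ,
      Fin.init (w ∘ ρ) = fun j => Fin.init w (Fin.natAdd l j) := by
    intro w; ext j; simp [Fin.init, ρ]
  have hlast : ∀ w : Fin (l + d + 1) → ℝ, (w ∘ ρ) (Fin.last d) = w (Fin.last (l + d)) := by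
    intro w; simp [ρ]
  ext w
  simp only [mem_setOf_eq, mem_inter_iff, mem_preimage, hinit, hlast]
  tauto

/-- A `ℚ`-semialgebraic function of the leading block, `z ↦ G (z|ₗ)`, is `ℚ`-semialgebraic on the
cylinder `A × B` (no Tarski–Seidenberg). [BCR 1998, §2.2] [cite: BochnakCosteRoy1998, §2.2] -/
theorem isSemialgebraicFunOn_cylinder_left {A : Set (Fin l → ℝ)} {B : Set (Fin d → ℝ)}
    {G : (Fin l → ℝ) → ℝ} (hA : Literature.ModelTheory.ExponentialFields.IsSemialgebraic ℚ A) (hB : Literature.ModelTheory.ExponentialFields.IsSemialgebraic ℚ B)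
    (hG : IsSemialgebraicFunOn ℚ A G) :
    IsSemialgebraicFunOn ℚ {z : Fin (l + d) → ℝ | (fun i => z (Fin.castAdd d i)) ∈ A ∧
      (fun j => z (Fin.natAdd l j)) ∈ B} (fun z => G fun i => z (Fin.castAdd d i)) := by
  rw [isSemialgebraicFunOn_iff]
  let ρ : Fin (l + 1) → Fin (l + d + 1) :=
    Fin.lastCases (Fin.last (l + d)) fun i => Fin.castSucc (Fin.castAdd d i)
  have hΓ := (isSemialgebraicFunOn_iff.mp hG).preimage_comp ρ
  convert (isSemialgebraic_cylinder hA hB).setOf_init_mem.inter hΓ using 1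
  have hinit : ∀ w : Fin (l + d + 1) → ℝ,
      Fin.init (w ∘ ρ) = fun i => Fin.init w (Fin.castAdd d i) := by
    intro w; ext i; simp [Fin.init, ρ]
  have hlast : ∀ w : Fin (l + d + 1) → ℝ, (w ∘ ρ) (Fin.last l) = w (Fin.last (l + d)) := by
    intro w; simp [ρ]
  ext w
  simp only [mem_setOf_eq, mem_inter_iff, mem_preimage, hinit, hlast]
  tauto


/-! ### Block maps `(y, x) ↦ (y, Φ x)` -/

/-- A vector equals `Fin.append a b` iff its two blocks are `a` and `b`. [folklore] -/
theorem eq_append_iff {α : Type*} (v : Fin (l + n) → α) (a : Fin l → α) (b : Fin n → α) :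
    v = Fin.append a b ↔
      (fun i => v (Fin.castAdd n i)) = a ∧ (fun j => v (Fin.natAdd l j)) = b := by
  constructor
  · rintro rfl
    exact ⟨funext fun i => Fin.append_left a b i, funext fun j => Fin.append_right a b j⟩
  · rintro ⟨rfl, rfl⟩
    exact (Fin.append_castAdd_natAdd).symm

/-- The block map `(y, x) ↦ (y, Φ x)` on a cylinder `A × σ` is a `ℚ`-semialgebraic map when `Φ` is
`ℚ`-semialgebraic on `σ`: its graph is the intersection of a coordinate preimage of the graph of
`Φ`, a coordinate preimage of `A`, and the coordinate equalities `y' = y` (no Tarski–Seidenberg).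
[BCR 1998, §2.2] [cite: BochnakCosteRoy1998, §2.2] -/
theorem isSemialgebraicMapOn_blockMap {A : Set (Fin l → ℝ)} {σ : Set (Fin n → ℝ)}
    {Φ : (Fin n → ℝ) → (Fin n → ℝ)} (hA : Literature.ModelTheory.ExponentialFields.IsSemialgebraic ℚ A) (hΦ : IsSemialgebraicMapOn ℚ σ Φ) :
    IsSemialgebraicMapOn ℚ {z : Fin (l + n) → ℝ | (fun i => z (Fin.castAdd n i)) ∈ A ∧
        (fun j => z (Fin.natAdd l j)) ∈ σ}
      (fun z => Fin.append (fun i => z (Fin.castAdd n i)) (Φ fun j => z (Fin.natAdd l j))) := by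
  rw [isSemialgebraicMapOn_iff]
  have hG := isSemialgebraicMapOn_iff.mp hΦ
  let ρ : Fin (n + n) → Fin (l + n + (l + n)) :=
    Fin.append (fun j => Fin.castAdd (l + n) (Fin.natAdd l j))
      (fun j => Fin.natAdd (l + n) (Fin.natAdd l j))
  have h1 := hG.preimage_comp ρ
  have h2 := hA.preimage_comp (fun i : Fin l => Fin.castAdd (l + n) (Fin.castAdd n i))
  have h3 : Literature.ModelTheory.ExponentialFields.IsSemialgebraic ℚ (⋂ i ∈ (Finset.univ : Finset (Fin l)),
      {w : Fin (l + n + (l + n)) → ℝ |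
        w (Fin.natAdd (l + n) (Fin.castAdd n i)) = w (Fin.castAdd (l + n) (Fin.castAdd n i))}) := by
    refine Literature.ModelTheory.ExponentialFields.IsSemialgebraic.biInter Finset.univ _ fun i _ => ?_
    convert Literature.ModelTheory.ExponentialFields.isSemialgebraic_setOf_eval_eq_zero (k := ℚ) (R := ℝ)
      (X (Fin.natAdd (l + n) (Fin.castAdd n i)) -
        X (Fin.castAdd (l + n) (Fin.castAdd n i)) : MvPolynomial (Fin (l + n + (l + n))) ℚ) using 1
    ext w
    simp [sub_eq_zero]
  have hρa : ∀ (w : Fin (l + n + (l + n)) → ℝ) (i : Fin n),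
      (w ∘ ρ) (Fin.castAdd n i) = w (Fin.castAdd (l + n) (Fin.natAdd l i)) := by
    intro w i
    simp only [Function.comp_apply, ρ, Fin.append_left]
  have hρb : ∀ (w : Fin (l + n + (l + n)) → ℝ) (j : Fin n),
      (w ∘ ρ) (Fin.natAdd n j) = w (Fin.natAdd (l + n) (Fin.natAdd l j)) := by
    intro w j
    simp only [Function.comp_apply, ρ, Fin.append_right]
  convert h2.inter (h1.inter h3) using 1
  ext w
  simp only [mem_setOf_eq, mem_inter_iff, mem_preimage, mem_iInter, Finset.mem_univ, true_imp_iff,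
    eq_append_iff]
  simp only [hρa, hρb]
  simp only [Function.comp_def, funext_iff]
  tauto

/-! ### Left products that resolve -/

namespace IntegralRep

/-- **Left products with `t = [τ, g]` resolve semialgebraically**: for every `ℚ`-semialgebraic
function `F` on a `ℚ`-semialgebraic `B ⊆ ℝᵈ`, the function `z ↦ g (z|ₗ) · F (z|ᵈ)` is
`ℚ`-semialgebraic on the cylinder `τ × B ⊆ ℝˡ⁺ᵈ`. With `F` the integrand of a representation `s`
this says that the classical `if` in `IntegralRep.prod t s` takes its intended branch
(`LeftResolves.prod_integrand`); with `F` a Newton–Leibniz primitive it makes `g ⊗ F` an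
admissible primitive. It holds for every `t` (`IntegralRep.leftResolves`, from the Tarski–Seidenberg
theorem `Literature.ModelTheory.ExponentialFields.tarski_seidenberg_real_holds` via `IsSemialgebraicFunOn.mul_of_tarskiSeidenberg`,
BCR Prop. 2.2.6), and for `t = [π]` already without Tarski–Seidenberg (`piRep_leftResolves`); it is
kept as a named predicate because the move-by-move lemmas below use nothing else about `t`.
[Bochnak–Coste–Roy 1998, Prop. 2.2.6] [cite: BochnakCosteRoy1998, Prop. 2.2.6] -/
def LeftResolves (t : IntegralRep l) : Prop :=
  ∀ ⦃d : ℕ⦄ ⦃B : Set (Fin d → ℝ)⦄ ⦃F : (Fin d → ℝ) → ℝ⦄, Literature.ModelTheory.ExponentialFields.IsSemialgebraic ℚ B →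
    IsSemialgebraicFunOn ℚ B F →
      IsSemialgebraicFunOn ℚ {z : Fin (l + d) → ℝ | (fun i => z (Fin.castAdd d i)) ∈ t.domain ∧
          (fun j => z (Fin.natAdd l j)) ∈ B}
        (fun z => t.integrand (fun i => z (Fin.castAdd d i)) * F (fun j => z (Fin.natAdd l j)))

variable {t : IntegralRep l}

/-- If left products with `t` resolve then `g ⊗ f` is `ℚ`-semialgebraic on `τ × σ` for every
representation `s = [σ, f]`. [BCR 1998, Prop. 2.2.6] [cite: BochnakCosteRoy1998, Prop. 2.2.6] -/
theorem LeftResolves.isSemialgebraicFunOn_prodFun (ht : t.LeftResolves) (s : IntegralRep m) :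
    IsSemialgebraicFunOn ℚ (IntegralRep.prodDomain t s) (IntegralRep.prodFun t s) :=
  ht s.isSemialgebraic_domain s.isSemialgebraicFunOn_integrand

/-- If left products with `t` resolve then the integrand of `t.prod s` is `g ⊗ f` (the `if` in
`IntegralRep.prod` takes its intended branch). [KZ 2001, §4.1] [cite: KontsevichZagier2001, §4.1] -/
theorem LeftResolves.prod_integrand (ht : t.LeftResolves) (s : IntegralRep m) :
    (t.prod s).integrand = IntegralRep.prodFun t s :=
  IntegralRep.prod_integrand_of t s (ht.isSemialgebraicFunOn_prodFun s)

/-- **Every representation resolves**: `z ↦ g (z|ₗ) · F (z|ᵈ)` is the product of two functions that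
are `ℚ`-semialgebraic on the cylinder (`isSemialgebraicFunOn_cylinder_left/right`), hence
`ℚ`-semialgebraic by closure of real semialgebraic functions under products
(`IsSemialgebraicFunOn.mul_of_tarskiSeidenberg`, BCR Prop. 2.2.6), available now that the
Tarski–Seidenberg projection theorem is proved in the tree (`Literature.ModelTheory.ExponentialFields.tarski_seidenberg_real_holds`,
`Literature/ModelTheory/ExponentialFields/TarskiSeidenbergProofs.lean`).
[Bochnak–Coste–Roy 1998, Prop. 2.2.6] [cite: BochnakCosteRoy1998, Prop. 2.2.6] -/
theorem leftResolves (t : IntegralRep l) : t.LeftResolves :=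
  fun _ _ _ hB hF => IsSemialgebraicFunOn.mul_of_tarskiSeidenberg Literature.ModelTheory.ExponentialFields.tarski_seidenberg_real_holds
    (isSemialgebraicFunOn_cylinder_left t.isSemialgebraic_domain hB
      t.isSemialgebraicFunOn_integrand)
    (isSemialgebraicFunOn_cylinder_right t.isSemialgebraic_domain hB hF)

end IntegralRep

open IntegralRep

variable {t : IntegralRep l}

/-! ### The four moves under `[t] * ·` -/

/-- **`[t] * (domain additivity)` is a domain-additivity move**:
`τ × (σ₁ ∪ σ₂) = (τ × σ₁) ∪ (τ × σ₂)` with `vol ((τ × σ₁) ∩ (τ × σ₂)) = vol τ · vol (σ₁ ∩ σ₂) = 0`,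
and `g ⊗ f = g ⊗ fᵢ` on `τ × σᵢ`. (cf. Kontsevich–Zagier 2001, §1.2 rule (1), §4.1; not spelled
out in print for this calculus.) [folklore] -/
theorem of_mul_mem_relations_of_mem_domainAddRel (ht : t.LeftResolves) {c : FormalRep}
    (hc : c ∈ domainAddRel) : of t * c ∈ relations := by
  obtain ⟨n, r, r₁, r₂, hdom, hnull, h₁, h₂, rfl⟩ := hc
  rw [mul_sub, mul_sub, of_mul_of, of_mul_of, of_mul_of]
  refine domainAddRel_subset_relations ⟨l + n, t.prod r, t.prod r₁, t.prod r₂, ?_, ?_, ?_, ?_, rfl⟩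
  · ext z
    simp only [prod_domain, mem_prodDomain, hdom, mem_union]
    tauto
  · have hsub : (t.prod r₁).domain ∩ (t.prod r₂).domain =
        {z : Fin (l + n) → ℝ | (fun i => z (Fin.castAdd n i)) ∈ t.domain ∧
          (fun j => z (Fin.natAdd l j)) ∈ r₁.domain ∩ r₂.domain} := by
      ext z
      simp only [prod_domain, mem_inter_iff, mem_prodDomain, mem_setOf_eq]
      tauto
    rw [hsub, volume_cylinder, hnull, mul_zero]
  · intro z hz
    rw [ht.prod_integrand, ht.prod_integrand, prodFun_apply, prodFun_apply, h₁ hz.2]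
  · intro z hz
    rw [ht.prod_integrand, ht.prod_integrand, prodFun_apply, prodFun_apply, h₂ hz.2]

/-- **`[t] * (integrand additivity)` is an integrand-additivity move**:
`g ⊗ (f₁ + f₂) = g ⊗ f₁ + g ⊗ f₂` on `τ × σ`. (cf. Kontsevich–Zagier 2001, §1.2 rule (1), §4.1.)
[folklore] -/
theorem of_mul_mem_relations_of_mem_integrandAddRel (ht : t.LeftResolves) {c : FormalRep}
    (hc : c ∈ integrandAddRel) : of t * c ∈ relations := by
  obtain ⟨n, r, r₁, r₂, h₁, h₂, hadd, rfl⟩ := hc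
  rw [mul_sub, mul_sub, of_mul_of, of_mul_of, of_mul_of]
  refine integrandAddRel_subset_relations ⟨l + n, t.prod r, t.prod r₁, t.prod r₂, ?_, ?_, ?_, rfl⟩
  · ext z
    simp only [prod_domain, mem_prodDomain, h₁]
  · ext z
    simp only [prod_domain, mem_prodDomain, h₂]
  · intro z hz
    rw [ht.prod_integrand, ht.prod_integrand, ht.prod_integrand, Pi.add_apply, prodFun_apply,
      prodFun_apply, prodFun_apply, hadd hz.2, Pi.add_apply, mul_add]

/-- **`[t] * (Newton–Leibniz)` is a Newton–Leibniz move.** If `[r] − [r']` is the printed rule (3)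
along the last coordinate over the base `τ'` with bounds `a ≤ b` and primitive `F`, then
`τ × band = {(y, x, s) | (y, x) ∈ τ × τ', a x ≤ s ≤ b x}` is again a band in the last coordinate
(`Fin (l + (n + 1)) = Fin ((l + n) + 1)` definitionally), over the base `τ × τ'`, with bounds
`a ∘ pr₂ ≤ b ∘ pr₂` and primitive `(y, x, s) ↦ g y · F (x, s)`: fibrewise it is a constant multiple
of the old primitive, so continuity on `[a x, b x]` and the derivative `g y · f (x, s) = (g ⊗ f)` on
`(a x, b x)` are inherited, and `(g ⊗ r') (y, x) = g y · (F (x, b x) − F (x, a x))`.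
Semialgebraicity of the new primitive is exactly the hypothesis `LeftResolves t`.
(cf. Kontsevich–Zagier 2001, §1.2 rule (3), §4.1; not spelled out in print for this calculus.)
[folklore] -/
theorem of_mul_mem_relations_of_mem_newtonLeibnizRel (ht : t.LeftResolves) {c : FormalRep}
    (hc : c ∈ newtonLeibnizRel) : of t * c ∈ relations := by
  obtain ⟨n, r, r', a, b, F, hF, ha, hb, hab, hdom, hcont, hderiv, hr', rfl⟩ := hc
  rw [mul_sub, of_mul_of, of_mul_of]
  refine newtonLeibnizRel_subset_relations ⟨l + n, t.prod r, t.prod r',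
    fun z => a (fun j => z (Fin.natAdd l j)), fun z => b (fun j => z (Fin.natAdd l j)),
    fun w => t.integrand (fun i => w (Fin.castAdd (n + 1) i)) * F (fun j => w (Fin.natAdd l j)),
    ?_, ?_, ?_, ?_, ?_, ?_, ?_, ?_, rfl⟩
  · exact ht r.isSemialgebraic_domain hF
  · exact isSemialgebraicFunOn_cylinder_right t.isSemialgebraic_domain r'.isSemialgebraic_domain ha
  · exact isSemialgebraicFunOn_cylinder_right t.isSemialgebraic_domain r'.isSemialgebraic_domain hb
  · intro z hz
    exact hab _ hz.2
  · ext w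
    simp only [prod_domain, mem_prodDomain, mem_setOf_eq, init_castAdd, init_natAdd, hdom,
      apply_natAdd_last]
    tauto
  · intro z hz
    simp only [Fin.snoc_castAdd, snoc_natAdd]
    exact continuousOn_const.mul (hcont _ hz.2)
  · intro z hz s hs
    simp only [Fin.snoc_castAdd, snoc_natAdd]
    refine ((hderiv _ hz.2 s hs).const_mul
      (t.integrand fun i => z (Fin.castAdd n i))).congr_deriv ?_
    rw [ht.prod_integrand, prodFun_apply]
    simp only [Fin.snoc_castAdd, snoc_natAdd]
  · intro z hz
    rw [ht.prod_integrand, prodFun_apply, hr' _ hz.2, mul_sub]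
    simp only [Fin.snoc_castAdd, snoc_natAdd]

/-- **`[t] * (change of variables)` is a change-of-variables move**: for `Φ` on `σ` as in rule (2),
the block map `Ψ (y, x) = (y, Φ x)` on `τ × σ` is `ℚ`-semialgebraic
(`isSemialgebraicMapOn_blockMap`),
injective, has derivative `id × Φ' x` within `τ × σ` (chain rule through the linear identification
`ℝˡ × ℝⁿ ≃ ℝˡ⁺ⁿ`, `HasFDerivWithinAt.prodMap`), image `τ × Φ '' σ`, and
`|det (id × Φ' x)| = |det Φ' x|` (`LinearMap.det_conj`, `LinearMap.det_prodMap`), so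
`g ⊗ f = (g ⊗ f') ∘ Ψ · |det Ψ'|` on `τ × σ`.
(cf. Kontsevich–Zagier 2001, §1.2 rule (2), §4.1; not spelled out in print for this calculus.)
[folklore] -/
theorem of_mul_mem_relations_of_mem_changeOfVariablesRel (ht : t.LeftResolves) {c : FormalRep}
    (hc : c ∈ changeOfVariablesRel) : of t * c ∈ relations := by
  obtain ⟨n, r, r', Φ, Φ', hΦ, hΦ', hinj, hdom, hf, rfl⟩ := hc
  rw [mul_sub, of_mul_of, of_mul_of]
  -- the linear identification `ℝˡ × ℝⁿ ≃ ℝˡ⁺ⁿ`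
  let e : ((Fin l → ℝ) × (Fin n → ℝ)) ≃ₗ[ℝ] (Fin (l + n) → ℝ) :=
    { toFun := fun p => Fin.append p.1 p.2
      invFun := fun z => (fun i => z (Fin.castAdd n i), fun j => z (Fin.natAdd l j))
      map_add' := fun p q => by
        ext i; refine Fin.addCases (fun i => ?_) (fun j => ?_) i <;> simp
      map_smul' := fun c p => by
        ext i; refine Fin.addCases (fun i => ?_) (fun j => ?_) i <;> simp
      left_inv := fun p => by ext <;> simp
      right_inv := fun z => by
        ext i; refine Fin.addCases (fun i => ?_) (fun j => ?_) i <;> simp }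
  let eL : ((Fin l → ℝ) × (Fin n → ℝ)) ≃L[ℝ] (Fin (l + n) → ℝ) := e.toContinuousLinearEquiv
  have heL : ∀ p, eL p = Fin.append p.1 p.2 := fun p => rfl
  have heL_symm : ∀ z, eL.symm z = (fun i => z (Fin.castAdd n i), fun j => z (Fin.natAdd l j)) :=
    fun z => rfl
  -- the block map and its derivative
  let Ψ : (Fin (l + n) → ℝ) → (Fin (l + n) → ℝ) := eL ∘ Prod.map id Φ ∘ eL.symm
  let Ψ' : (Fin (l + n) → ℝ) → (Fin (l + n) → ℝ) →L[ℝ] (Fin (l + n) → ℝ) := fun z =>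
    (eL : _ →L[ℝ] _).comp ((((ContinuousLinearMap.id ℝ (Fin l → ℝ)).prodMap
      (Φ' (fun j => z (Fin.natAdd l j)))).comp (eL.symm : _ →L[ℝ] _)))
  have hΨ : ∀ z, Ψ z = Fin.append (fun i => z (Fin.castAdd n i)) (Φ fun j => z (Fin.natAdd l j)) :=
    fun z => rfl
  have hdet : ∀ z, (Ψ' z).det = (Φ' (fun j => z (Fin.natAdd l j))).det := by
    intro z
    have hcoe : ((Ψ' z : (Fin (l + n) → ℝ) →L[ℝ] (Fin (l + n) → ℝ)) :
        (Fin (l + n) → ℝ) →ₗ[ℝ] (Fin (l + n) → ℝ)) =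
      (e : ((Fin l → ℝ) × (Fin n → ℝ)) →ₗ[ℝ] (Fin (l + n) → ℝ)) ∘ₗ
        (((LinearMap.id : (Fin l → ℝ) →ₗ[ℝ] (Fin l → ℝ)).prodMap
          ((Φ' (fun j => z (Fin.natAdd l j)) : (Fin n → ℝ) →L[ℝ] (Fin n → ℝ)) :
            (Fin n → ℝ) →ₗ[ℝ] (Fin n → ℝ))) ∘ₗ
        (e.symm : (Fin (l + n) → ℝ) →ₗ[ℝ] ((Fin l → ℝ) × (Fin n → ℝ)))) :=
      LinearMap.ext fun v => rfl
    change LinearMap.det _ = LinearMap.det _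
    rw [hcoe, LinearMap.det_conj, LinearMap.det_prodMap, LinearMap.det_id, one_mul]
  have hS : (t.prod r).domain = eL.symm ⁻¹' (t.domain ×ˢ r.domain) := rfl
  refine changeOfVariablesRel_subset_relations
    ⟨l + n, t.prod r, t.prod r', Ψ, Ψ', ?_, ?_, ?_, ?_, ?_, rfl⟩
  · exact (isSemialgebraicMapOn_blockMap t.isSemialgebraic_domain hΦ).congr fun z _ => (hΨ z).symm
  · intro z hz
    have hx : (fun j => z (Fin.natAdd l j)) ∈ r.domain := hz.2
    have hg : HasFDerivWithinAt (Prod.map id Φ)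
        ((ContinuousLinearMap.id ℝ (Fin l → ℝ)).prodMap (Φ' (fun j => z (Fin.natAdd l j))))
        (t.domain ×ˢ r.domain) (eL.symm z) := by
      refine HasFDerivWithinAt.prodMap (eL.symm z) (hasFDerivWithinAt_id _ _) ((hΦ' _ hx).mono ?_)
      rintro _ ⟨q, hq, rfl⟩
      exact hq.2
    have h2 := (eL.comp_hasFDerivWithinAt_iff).mpr hg
    have h3 := (eL.symm.comp_right_hasFDerivWithinAt_iff (f := eL ∘ Prod.map id Φ)).mpr h2
    rw [hS]
    exact h3
  · intro z₁ hz₁ z₂ hz₂ h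
    rw [hΨ, hΨ] at h
    have h' := congrArg (fun w : Fin (l + n) → ℝ =>
      ((fun i => w (Fin.castAdd n i)), (fun j => w (Fin.natAdd l j)))) h
    simp only [Fin.append_left, Fin.append_right, Prod.mk.injEq] at h'
    have h2 : (fun j => z₁ (Fin.natAdd l j)) = fun j => z₂ (Fin.natAdd l j) := hinj hz₁.2 hz₂.2 h'.2
    rw [← Fin.append_castAdd_natAdd (f := z₁), ← Fin.append_castAdd_natAdd (f := z₂), h'.1, h2]
  · ext w
    simp only [prod_domain, mem_prodDomain, hdom, mem_image]
    constructor
    · rintro ⟨hw₁, x, hx, hwx⟩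
      refine ⟨Fin.append (fun i => w (Fin.castAdd n i)) x,
        ⟨by simpa using hw₁, by simpa using hx⟩, ?_⟩
      rw [hΨ]
      simp only [Fin.append_left, Fin.append_right]
      conv_rhs => rw [← Fin.append_castAdd_natAdd (f := w)]
      simp [hwx]
    · rintro ⟨z, hz, rfl⟩
      rw [hΨ]
      simp only [Fin.append_left, Fin.append_right]
      exact ⟨by simpa using hz.1, _, hz.2, rfl⟩
  · intro z hz
    rw [ht.prod_integrand, ht.prod_integrand, prodFun_apply, hf _ hz.2, hdet, hΨ, prodFun_append,
      mul_assoc]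

/-! ### Assembly -/

/-- **Left products preserve relations** (relative to the resolution predicate): if left products
with `t` resolve then `c ∈ relations → [t] * c ∈ relations`, by `AddSubgroup.closure_induction`,
each generator being sent to a move of the same kind (`of_mul_mem_relations_of_mem_*`) and
`[t] * ·` being additive. See `of_mul_mem_relations` for the hypothesis-free form. [folklore] -/
theorem IntegralRep.LeftResolves.of_mul_mem_relations (ht : t.LeftResolves) {c : FormalRep}
    (hc : c ∈ relations) : of t * c ∈ relations := by
  refine AddSubgroup.closure_induction (fun x hx => ?_) ?_ (fun x y _ _ hx hy => ?_)
    (fun x _ hx => ?_) hc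
  · rcases hx with ((hx | hx) | hx) | hx
    · exact of_mul_mem_relations_of_mem_domainAddRel ht hx
    · exact of_mul_mem_relations_of_mem_integrandAddRel ht hx
    · exact of_mul_mem_relations_of_mem_changeOfVariablesRel ht hx
    · exact of_mul_mem_relations_of_mem_newtonLeibnizRel ht hx
  · rw [mul_zero]; exact relations.zero_mem
  · rw [mul_add]; exact relations.add_mem hx hy
  · rw [mul_neg]; exact relations.neg_mem hx

/-- **Left products preserve relations**: `c ∈ relations → [t] * c ∈ relations` for every
integral representation `t` (`IntegralRep.leftResolves` fed into
`IntegralRep.LeftResolves.of_mul_mem_relations`). This is the mechanism behind "the effective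
periods form an algebra because the product of integrals is again an integral (Fubini formula)"
[Kontsevich 1999, §4.3, p. 16; Kontsevich–Zagier 2001, §4.1, p. 31] at the level of KZ's rules
(1)–(3); not spelled out in print for this calculus. It supersedes the cell-decomposition sketch in
the docstring of `Literature.NumberTheory.Transcendental.KZ.mul_mem_relations_left` (`KZProduct.lean`): the fibrewise form of the
Newton–Leibniz move needs no `C¹` regularity of the factor `g`. [folklore] -/
theorem of_mul_mem_relations (t : IntegralRep l) {c : FormalRep} (hc : c ∈ relations) :
    of t * c ∈ relations :=
  t.leftResolves.of_mul_mem_relations hc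

/-- **Discharge of the named fact `Literature.NumberTheory.Transcendental.KZ.mul_mem_relations_left`** (`relations` is a left ideal:
`c ∈ relations → c' * c ∈ relations`): additivity in `c'` (`FreeAbelianGroup.induction_on`) from
`of_mul_mem_relations`. (cf. Kontsevich 1999, §4.3, p. 16; Kontsevich–Zagier 2001, §1.2, §4.1;
Huber–Müller-Stach 2017, §13.1; folklore for this calculus.) [folklore] -/
theorem mul_mem_relations_left_holds : mul_mem_relations_left := by
  intro c c' hc
  induction c' using FreeAbelianGroup.induction_on with
  | zero => rw [zero_mul]; exact relations.zero_mem
  | of x =>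
    obtain ⟨l, t⟩ := x
    exact of_mul_mem_relations t hc
  | neg x ih => rw [neg_mul]; exact relations.neg_mem ih
  | add x y hx hy => rw [add_mul]; exact relations.add_mem hx hy

/-- **Left products with `[π]` resolve**, directly and without Tarski–Seidenberg: the integrand
of `[π]` is `1`, so `1 ⊗ F = F ∘ pr₂` is `ℚ`-semialgebraic on `disc × B` by
`isSemialgebraicFunOn_cylinder_right`. (A special case of `IntegralRep.leftResolves`, kept to record
that the `[π]`-part of the file does not depend on the projection theorem.)
[BCR 1998, §2.2] [cite: BochnakCosteRoy1998, §2.2] -/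
theorem piRep_leftResolves : piRep.LeftResolves := by
  intro d B F hB hF
  refine (isSemialgebraicFunOn_cylinder_right piRep.isSemialgebraic_domain hB hF).congr ?_
  intro z _
  simp

/-- **`[π] * relations ⊆ relations`**: multiplication by
`[π] = [{x² + y² ≤ 1}, 1]` preserves the relations of the KZ calculus, i.e. `[π] * ·` is well
defined on formal periods `FormalRep ⧸ relations`. This is the (easy, structural) converse
companion of the open thesis `PiCancellation` (`[π] * c ∈ relations → c ∈ relations`).
Motivation: the passage `P = P₊[(2πi)⁻¹]` [Kontsevich 1999, §4.3, p. 16; Kontsevich–Zagier 2001,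
§4.1, p. 31]; the statement for this calculus is not in print. [folklore] -/
theorem piRep_mul_mem_relations {c : FormalRep} (hc : c ∈ relations) : of piRep * c ∈ relations :=
  piRep_leftResolves.of_mul_mem_relations hc

/-- Iterated left multiplication by `[π]` (left-nested, as in `PiLocalKernel`) preserves relations.
[folklore] -/
theorem piRep_mul_iterate_mem_relations (N : ℕ) {c : FormalRep} (hc : c ∈ relations) :
    (fun x => of piRep * x)^[N] c ∈ relations := by
  induction N with
  | zero => exact hc
  | succ N ih => rw [Function.iterate_succ_apply']; exact piRep_mul_mem_relations ih

/-- Equivalent representations have equivalent `[π]`-multiples: `r ∼ r' → [π]·r ∼ [π]·r'`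
(from `piRep_mul_mem_relations` with `c = [r] − [r']`). [folklore] -/
theorem Equivalent.piRep_prod {r : IntegralRep n} {r' : IntegralRep m} (h : Equivalent r r') :
    Equivalent (piRep.prod r) (piRep.prod r') := by
  have h' := piRep_mul_mem_relations h
  rwa [mul_sub, of_mul_of, of_mul_of] at h'

/-- **`[π] * ·` on formal periods.** Left multiplication by `[π]` descends to an endomorphism of
the formal period group `FormalRep ⧸ relations` (well defined by `piRep_mul_mem_relations`).
[Kontsevich 1999, §4.3, p. 16 (`P = P₊[(2πi)⁻¹]`); the KZ-calculus version is not in print]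
[folklore] -/
def piMulQuot : FormalRep ⧸ relations →+ FormalRep ⧸ relations :=
  QuotientAddGroup.map relations relations (FormalRep.mul (of piRep))
    fun _ hc => piRep_mul_mem_relations hc

/-- `piMulQuot` on the class of `c` is the class of `[π] * c`. [folklore] -/
@[simp] theorem piMulQuot_mk (c : FormalRep) :
    piMulQuot (c : FormalRep ⧸ relations) = ((of piRep * c : FormalRep) : FormalRep ⧸ relations) :=
  rfl

/-- **`PiCancellation` is regularity of `[π]` on formal periods**: the thesis
`∀ c, [π] * c ∈ relations → c ∈ relations` of route AyoubSpecialisation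
(stmt-KontsevichZagierPeriods-0540) holds iff the endomorphism `piMulQuot` of
`FormalRep ⧸ relations` induced by `[π] * ·` is injective. Nothing is asserted about either side:
the motivic form of this injectivity (`P̃(MM^eff_Nori) → P̃(MM_Nori) = P̃^eff[1/2πi]` injective) is
an open question [Huber–Wüstholz 2022, App. A, p. 200], implied by the period conjecture
(ibid. Prop. 7.17). (cf. Kontsevich 1999, §4.3, p. 16; Kontsevich–Zagier 2001, §4.1, p. 31:
`P = P₊[(2πi)⁻¹]`.) [folklore] -/
theorem piCancellation_iff_injective : PiCancellation ↔ Function.Injective piMulQuot := by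
  rw [injective_iff_map_eq_zero]
  constructor
  · intro h x hx
    induction x using QuotientAddGroup.induction_on with
    | H c =>
      rw [piMulQuot_mk, QuotientAddGroup.eq_zero_iff] at hx
      exact (QuotientAddGroup.eq_zero_iff c).mpr (h c hx)
  · intro h c hc
    have := h (c : FormalRep ⧸ relations)
      (by rw [piMulQuot_mk, QuotientAddGroup.eq_zero_iff]; exact hc)
    exact (QuotientAddGroup.eq_zero_iff c).mp this

variable {k : ℕ}

/-! ### Reindexing coordinates is a move -/

namespace IntegralRep

/-- **Reindexing coordinates.** The integral representation obtained from `r = [σ, f]` by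
relabelling coordinates along `e : Fin n ≃ Fin k`: domain `{w | (w ∘ e) ∈ σ}`, integrand
`w ↦ f (w ∘ e)` (semialgebraic as coordinate preimages; integrable because `w ↦ w ∘ e` preserves
Lebesgue measure, `volume_measurePreserving_piCongrLeft`). Used for the block flip
`σ × τ ↔ τ × σ` (`prod_eq_reindex_prod`). [Kontsevich–Zagier 2001, §1.2 rule (2)]
[cite: KontsevichZagier2001, §1.2] -/
def reindex (r : IntegralRep n) (e : Fin n ≃ Fin k) : IntegralRep k where
  domain := {w | (fun i => w (e i)) ∈ r.domain}
  integrand := fun w => r.integrand (fun i => w (e i))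
  isSemialgebraic_domain := r.isSemialgebraic_domain.preimage_comp e
  isSemialgebraicFunOn_integrand := by
    rw [isSemialgebraicFunOn_iff]
    let ρ : Fin (n + 1) → Fin (k + 1) := Fin.lastCases (Fin.last k) fun i => Fin.castSucc (e i)
    have hΓ := (isSemialgebraicFunOn_iff.mp r.isSemialgebraicFunOn_integrand).preimage_comp ρ
    convert hΓ using 1
    have hinit : ∀ w : Fin (k + 1) → ℝ, Fin.init (w ∘ ρ) = fun i => Fin.init w (e i) := by
      intro w; ext i; simp [Fin.init, ρ]
    have hlast : ∀ w : Fin (k + 1) → ℝ, (w ∘ ρ) (Fin.last n) = w (Fin.last k) := by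
      intro w; simp [ρ]
    ext w
    simp only [mem_setOf_eq, mem_preimage, hinit, hlast]
  integrableOn := by
    have hmp : MeasurePreserving (MeasurableEquiv.piCongrLeft (fun _ : Fin n => ℝ) e.symm)
        (volume : Measure (Fin k → ℝ)) (volume : Measure (Fin n → ℝ)) :=
      volume_measurePreserving_piCongrLeft (fun _ : Fin n => ℝ) e.symm
    have happ : ∀ w : Fin k → ℝ,
        MeasurableEquiv.piCongrLeft (fun _ : Fin n => ℝ) e.symm w = fun i => w (e i) := by
      intro w; ext i
      simpa using MeasurableEquiv.piCongrLeft_apply_apply e.symm (β := fun _ : Fin n => ℝ) w (e i)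
    have h := (hmp.integrableOn_comp_preimage (MeasurableEquiv.piCongrLeft (fun _ : Fin n => ℝ)
      e.symm).measurableEmbedding).mpr r.integrableOn
    have hfun : (fun w : Fin k → ℝ => r.integrand fun i => w (e i)) =
        r.integrand ∘ (MeasurableEquiv.piCongrLeft (fun _ : Fin n => ℝ) e.symm) := by
      ext w; rw [Function.comp_apply, happ]
    have hset : {w : Fin k → ℝ | (fun i => w (e i)) ∈ r.domain} =
        (MeasurableEquiv.piCongrLeft (fun _ : Fin n => ℝ) e.symm) ⁻¹' r.domain := by
      ext w; rw [mem_preimage, happ, mem_setOf_eq]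
    rw [hfun, hset]
    exact h

variable (r : IntegralRep n) (e : Fin n ≃ Fin k)

/-- The domain of a reindexed representation. [folklore] -/
@[simp] theorem reindex_domain : (r.reindex e).domain = {w | (fun i => w (e i)) ∈ r.domain} := rfl

/-- The integrand of a reindexed representation. [folklore] -/
@[simp] theorem reindex_integrand :
    (r.reindex e).integrand = fun w => r.integrand (fun i => w (e i)) := rfl

end IntegralRep

/-- **Reindexing coordinates is a change-of-variables move**: `[r] − [r.reindex e] ∈ relations`.
Since `e : Fin n ≃ Fin k` forces `k = n`, the map `Φ z = z ∘ e⁻¹` is a coordinate permutation of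
`ℝⁿ`: linear (its own derivative), injective, a `ℚ`-polynomial map (`isSemialgebraicMapOn_aeval`),
with `Φ '' σ = {w | w ∘ e ∈ σ}`, `f = (f ∘ (· ∘ e)) ∘ Φ`, and `|det Φ| = 1` (a permutation matrix:
`Matrix.abs_det_submatrix_equiv_equiv`). [Kontsevich–Zagier 2001, §1.2 rule (2)]
[cite: KontsevichZagier2001, §1.2] -/
theorem of_sub_of_reindex_mem_relations (r : IntegralRep n) (e : Fin n ≃ Fin k) :
    of r - of (r.reindex e) ∈ relations := by
  obtain rfl : n = k := by simpa using Fintype.card_congr e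
  -- the linear map `z ↦ z ∘ e.symm` as a matrix
  let M : Matrix (Fin n) (Fin n) ℝ := (1 : Matrix (Fin n) (Fin n) ℝ).submatrix e.symm (Equiv.refl _)
  let L : (Fin n → ℝ) →L[ℝ] (Fin n → ℝ) := LinearMap.toContinuousLinearMap (Matrix.toLin' M)
  have hL : ∀ z : Fin n → ℝ, L z = fun j => z (e.symm j) := by
    intro z
    change Matrix.toLin' M z = _
    rw [Matrix.toLin'_apply, Matrix.submatrix_mulVec_equiv, Matrix.one_mulVec]
    rfl
  have hdet : |L.det| = 1 := by
    change |LinearMap.det (Matrix.toLin' M)| = 1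
    rw [LinearMap.det_toLin', Matrix.abs_det_submatrix_equiv_equiv, Matrix.det_one, abs_one]
  refine changeOfVariablesRel_subset_relations
    ⟨n, r, r.reindex e, fun z => fun j => z (e.symm j), fun _ => L, ?_, ?_, ?_, ?_, ?_, rfl⟩
  · -- semialgebraic: a coordinate (polynomial) map
    convert isSemialgebraicMapOn_aeval r.isSemialgebraic_domain
      (fun j => (X (e.symm j) : MvPolynomial (Fin n) ℚ)) using 2 with z
    ext j; simp
  · intro z _
    have h := L.hasFDerivWithinAt (s := r.domain) (x := z)
    convert h using 1
    ext z' j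
    rw [hL]
  · intro z₁ _ z₂ _ h
    ext i
    have := congrFun h (e i)
    simpa using this
  · ext w
    simp only [IntegralRep.reindex_domain, mem_setOf_eq, mem_image]
    constructor
    · intro hw
      exact ⟨fun i => w (e i), hw, by ext j; simp⟩
    · rintro ⟨z, hz, rfl⟩
      simpa using hz
  · intro z _
    rw [hdet, mul_one, IntegralRep.reindex_integrand]
    simp


/-! ### Commutativity of `*` modulo relations, and right products -/

namespace IntegralRep

/-- Two integral representations with the same domain and the same integrand are equal (the
remaining fields are proofs). [folklore] -/
theorem ext' {r r' : IntegralRep n} (h₁ : r.domain = r'.domain) (h₂ : r.integrand = r'.integrand) :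
    r = r' := by
  cases r; cases r'; cases h₁; cases h₂; rfl

variable (r : IntegralRep n) (s : IntegralRep m)

/-- The block flip `finAddFlip : Fin (m + n) ≃ Fin (n + m)` carries `τ × σ` to `σ × τ`.
[folklore] -/
theorem prodDomain_eq_reindex_domain :
    prodDomain r s = ((s.prod r).reindex finAddFlip).domain := by
  ext z
  simp only [mem_prodDomain, reindex_domain, prod_domain, mem_setOf_eq, finAddFlip_apply_castAdd,
    finAddFlip_apply_natAdd]
  exact and_comm

/-- `f ⊗ g` on `σ × τ` is the block flip of `g ⊗ f` on `τ × σ`, pointwise. [folklore] -/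
theorem prodFun_eq_prodFun_comp_flip (z : Fin (n + m) → ℝ) :
    prodFun r s z = prodFun s r (fun i => z (finAddFlip i)) := by
  simp only [prodFun_apply, finAddFlip_apply_castAdd, finAddFlip_apply_natAdd]
  exact mul_comm _ _

/-- Semialgebraicity of `f ⊗ g` on `σ × τ` and of `g ⊗ f` on `τ × σ` are equivalent (coordinate
flip; no Tarski–Seidenberg). [BCR 1998, §2.2] [cite: BochnakCosteRoy1998, §2.2] -/
theorem isSemialgebraicFunOn_prodFun_comm :
    IsSemialgebraicFunOn ℚ (prodDomain r s) (prodFun r s) ↔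
      IsSemialgebraicFunOn ℚ (prodDomain s r) (prodFun s r) := by
  constructor
  · intro h
    have hQ := ((r.prod s).reindex
      (finAddFlip : Fin (n + m) ≃ Fin (m + n))).isSemialgebraicFunOn_integrand
    rw [reindex_integrand, prod_integrand_of _ _ h, ← prodDomain_eq_reindex_domain] at hQ
    exact hQ.congr fun z _ => (prodFun_eq_prodFun_comp_flip s r z).symm
  · intro h
    have hQ := ((s.prod r).reindex
      (finAddFlip : Fin (m + n) ≃ Fin (n + m))).isSemialgebraicFunOn_integrand
    rw [reindex_integrand, prod_integrand_of _ _ h, ← prodDomain_eq_reindex_domain] at hQ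
    exact hQ.congr fun z _ => (prodFun_eq_prodFun_comp_flip r s z).symm

/-- **`[σ, f] * [τ, g]` is the block flip of `[τ, g] * [σ, f]`**, as integral representations
(unconditionally: the classical `if`s in the two products take the same branch by
`isSemialgebraicFunOn_prodFun_comm`). [Kontsevich–Zagier 2001, §4.1]
[cite: KontsevichZagier2001, §4.1] -/
theorem prod_eq_reindex_prod : r.prod s = (s.prod r).reindex finAddFlip := by
  refine ext' (prodDomain_eq_reindex_domain r s) ?_
  rw [reindex_integrand]
  by_cases h : IsSemialgebraicFunOn ℚ (prodDomain r s) (prodFun r s)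
  · rw [prod_integrand_of _ _ h,
      prod_integrand_of _ _ ((isSemialgebraicFunOn_prodFun_comm r s).mp h)]
    ext z
    exact prodFun_eq_prodFun_comp_flip r s z
  · have h' : ¬ IsSemialgebraicFunOn ℚ (prodDomain s r) (prodFun s r) :=
      fun h' => h ((isSemialgebraicFunOn_prodFun_comm r s).mpr h')
    ext z
    simp [prod, h, h']

end IntegralRep

/-- **`*` is commutative modulo relations, on generators**: `[r] * [s] − [s] * [r] ∈ relations`
(the block flip is a change-of-variables move, `of_sub_of_reindex_mem_relations`).
[Kontsevich–Zagier 2001, §4.1 ("periods form an algebra")] [cite: KontsevichZagier2001, §4.1] -/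
theorem of_mul_of_sub_of_mul_of_mem_relations (r : IntegralRep n) (s : IntegralRep m) :
    of r * of s - of s * of r ∈ relations := by
  rw [of_mul_of, of_mul_of, IntegralRep.prod_eq_reindex_prod r s, ← neg_sub]
  exact relations.neg_mem (of_sub_of_reindex_mem_relations _ _)

/-- **`*` is commutative modulo relations**: `c * d − d * c ∈ relations` for all formal
combinations (biadditivity from the generator case).
[Kontsevich–Zagier 2001, §4.1] [cite: KontsevichZagier2001, §4.1] -/
theorem mul_sub_mul_comm_mem_relations (c d : FormalRep) : c * d - d * c ∈ relations := by
  induction c using FreeAbelianGroup.induction_on with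
  | zero => simp [relations.zero_mem]
  | of x =>
    induction d using FreeAbelianGroup.induction_on with
    | zero => simp [relations.zero_mem]
    | of y =>
      obtain ⟨n, r⟩ := x
      obtain ⟨m, s⟩ := y
      exact of_mul_of_sub_of_mul_of_mem_relations r s
    | neg y ih =>
      have : FreeAbelianGroup.of x * -FreeAbelianGroup.of y -
            -FreeAbelianGroup.of y * FreeAbelianGroup.of x =
          -(FreeAbelianGroup.of x * FreeAbelianGroup.of y -
            FreeAbelianGroup.of y * FreeAbelianGroup.of x) := by
        rw [neg_mul, mul_neg]; abel
      rw [this]; exact relations.neg_mem ih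
    | add y z hy hz =>
      have : FreeAbelianGroup.of x * (y + z) - (y + z) * FreeAbelianGroup.of x =
          (FreeAbelianGroup.of x * y - y * FreeAbelianGroup.of x) +
            (FreeAbelianGroup.of x * z - z * FreeAbelianGroup.of x) := by
        rw [mul_add, add_mul]; abel
      rw [this]; exact relations.add_mem hy hz
  | neg x ih =>
    have : -FreeAbelianGroup.of x * d - d * -FreeAbelianGroup.of x =
        -(FreeAbelianGroup.of x * d - d * FreeAbelianGroup.of x) := by
      rw [neg_mul, mul_neg]; abel
    rw [this]; exact relations.neg_mem ih
  | add x y hx hy =>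
    have : (x + y) * d - d * (x + y) = (x * d - d * x) + (y * d - d * y) := by
      rw [add_mul, mul_add]; abel
    rw [this]; exact relations.add_mem hx hy

/-- Right products preserve relations as soon as left products do:
`c * d = (c * d − d * c) + d * c`. [folklore] -/
theorem mul_mem_relations_of_left {c d : FormalRep} (h : d * c ∈ relations) :
    c * d ∈ relations := by
  have := relations.add_mem (mul_sub_mul_comm_mem_relations c d) h
  simpa using this

/-- **`relations * [π] ⊆ relations`**: right multiplication by `[π]` preserves the
relations, from `piRep_mul_mem_relations` and commutativity modulo relations. [folklore] -/
theorem mul_piRep_mem_relations {c : FormalRep} (hc : c ∈ relations) : c * of piRep ∈ relations :=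
  mul_mem_relations_of_left (piRep_mul_mem_relations hc)

/-- **Discharge of the named fact `Literature.NumberTheory.Transcendental.KZ.mul_mem_relations_right`** (`relations` is a right
ideal: `c ∈ relations → c * c' ∈ relations`), from the left ideal property
(`mul_mem_relations_left_holds`) and commutativity modulo relations
(`mul_sub_mul_comm_mem_relations`). (cf. Kontsevich–Zagier 2001, §1.2, §4.1; Huber–Müller-Stach
2017, §13.1; folklore for this calculus.) [folklore] -/
theorem mul_mem_relations_right_holds : mul_mem_relations_right :=
  fun c c' hc => mul_mem_relations_of_left (mul_mem_relations_left_holds c c' hc)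

/-- **`relations` is a two-sided ideal**: equivalent factors have equivalent products,
`c₁ − c₂ ∈ relations → d₁ − d₂ ∈ relations → c₁ * d₁ − c₂ * d₂ ∈ relations`
(`sub_mul_sub_mem_relations` of `KZProduct.lean` fed with the two discharged ideal facts), i.e.
`*` descends to the formal period group `FormalRep ⧸ relations`. [folklore] -/
theorem mul_sub_mul_mem_relations {c₁ c₂ d₁ d₂ : FormalRep} (hc : c₁ - c₂ ∈ relations)
    (hd : d₁ - d₂ ∈ relations) : c₁ * d₁ - c₂ * d₂ ∈ relations :=
  sub_mul_sub_mem_relations mul_mem_relations_left_holds mul_mem_relations_right_holds hc hd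

/-- Equivalent representations have equivalent products: `r ∼ r' → s ∼ s' → r × s ∼ r' × s'`.
[folklore] -/
theorem Equivalent.prod {n' m' : ℕ} {r : IntegralRep n} {r' : IntegralRep n'} {s : IntegralRep m}
    {s' : IntegralRep m'} (hr : Equivalent r r') (hs : Equivalent s s') :
    Equivalent (r.prod s) (r'.prod s') := by
  have h := mul_sub_mul_mem_relations hr hs
  rwa [of_mul_of, of_mul_of] at h

/-! ### Values of products (Fubini) -/

/-- **Discharge of `Literature.NumberTheory.Transcendental.KZ.ProdFunSemialgebraic`**: `f ⊗ g` is `ℚ`-semialgebraic on `σ × τ` for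
all pairs of representations (`prodFunSemialgebraic_of_mul` of `KZProduct.lean` fed with
`IsSemialgebraicFunOn.mul_of_tarskiSeidenberg tarski_seidenberg_real_holds`).
[Bochnak–Coste–Roy 1998, Prop. 2.2.6] [cite: BochnakCosteRoy1998, Prop. 2.2.6] -/
theorem prodFunSemialgebraic_holds : ProdFunSemialgebraic :=
  prodFunSemialgebraic_of_mul fun hf hg =>
    IsSemialgebraicFunOn.mul_of_tarskiSeidenberg Literature.ModelTheory.ExponentialFields.tarski_seidenberg_real_holds hf hg

/-- The integrand of `r.prod s` is `f ⊗ g` (the classical `if` in `IntegralRep.prod` always takes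
its intended branch). [Kontsevich–Zagier 2001, §4.1] [cite: KontsevichZagier2001, §4.1] -/
theorem IntegralRep.prod_integrand_eq (r : IntegralRep n) (s : IntegralRep m) :
    (r.prod s).integrand = IntegralRep.prodFun r s :=
  IntegralRep.prod_integrand_of r s (prodFunSemialgebraic_holds r s)

/-- **Fubini for representations**: `value [σ × τ, f ⊗ g] = value [σ, f] · value [τ, g]`.
[Kontsevich 1999, §4.3, p. 16; Kontsevich–Zagier 2001, §4.1, p. 31]
[cite: KontsevichZagier2001, §4.1] -/
theorem IntegralRep.value_prod (r : IntegralRep n) (s : IntegralRep m) :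
    (r.prod s).value = r.value * s.value :=
  IntegralRep.value_prod_of r s (prodFunSemialgebraic_holds r s)

/-- **`eval` is multiplicative**: `eval (c * c') = eval c * eval c'` (`eval_mul` of
`KZProduct.lean`, now unconditional). Together with `mul_sub_mul_mem_relations` this makes
`FormalRep ⧸ relations → ℝ` a multiplicative map of the formal period ring onto the ring of real
periods. [Kontsevich 1999, §4.3, p. 16; Kontsevich–Zagier 2001, §4.1, p. 31]
[cite: KontsevichZagier2001, §4.1] -/
theorem eval_mul' (c c' : FormalRep) : eval (c * c') = eval c * eval c' :=
  eval_mul prodFunSemialgebraic_holds c c'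


end KZ

end Literature.NumberTheory.Transcendental
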